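import Literature.MathematicalPhysics.QuantumFieldTheory.Balaban1983to89.MatrixLog
import Literature.MathematicalPhysics.QuantumFieldTheory.Balaban1983to89.B11V0Interface

/-!
# `Balaban1983to89.B11Eq155BlockLog` — T. Bałaban, *The variational problem and background fields in renormalization group method for lattice gauge theories*, Commun. Math. Phys. **102** (1985) 277–309 [Balaban1985Variational]: (154)–(155) p. 302 — the block-averaged configuration `V₁ = exp[−iΣ_{x₁∈B(x)}L^{−d}(1/i)log V″(Γ_{x,x₁})]V″(x,x′)` and the bound «V₁ = e^{iB} with |B| < 18d²L³Mε₀ (155) for c₁ sufficiently small», PROVED from (151) with an explicit smallness, over a complete normed ℂ-algebra (definitions with bodies + theorems)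

statement-level skeleton of published theorems with citation tags; proofs where landed; nothing here is a claim about the Yang–Mills mass gap

PDF held: `paper:balaban1985-cmp102-variational-background` (journal page = PDF page + 276); pp. 301–302 [PDF 25–26], renders
`run/shared/lean/pub/pub-balaban/b2b-balaban-ref1/pages/1985-cmp102-variational-background/…-p025-x2.png`, `…-p026-x2.png` READ AS IMAGES
(lit-balaban reader/typer r08, gen 5, 2026-08-21).

CITATION HEADER (lean-in-tree rule 2026-08-18).  WHAT IS REPRODUCED: SKELETON row `B11.Eq154` (= displays (154)–(156) p. 302; HOME
`run/shared/lean/pub/lit-balaban/lit-balaban-r08/ROWS-B11.md`), its member **(155)** — so far «typed by use; (155) absent» (the print gives the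
bound without a derivation).  Unit `lit-balaban-r08` (gen 5).  Siblings used BY NAME: `MatrixLog` (`mlog` = the logarithmic series (21) of [4] with
`exp_mlog`, `norm_mlog_le_div`; `Literature.Analysis.Calculus.norm_exp_sub_one_le`), `B11V0Interface` (`norm_list_prod_sub_one_le_mul`: a product
of `n` factors of norm `≤ 1` each `δ`-close to `1` is `nδ`-close to `1`).  [4] = [Balaban1985Averaging], [6] = [Balaban1985RegularSpaces].

THE PRINT (pp. 301–302, verbatim from the renders).  p. 301: «The bounds (146) imply |V″ − 1| < 9dL²Mε₀ − ε₀ on ℭ_k. (151) Now we apply Theorem 2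
of the paper [6] … We assume that 9dL²Mε₀ ≦ c₁.»  p. 302: «Ū₁ʲ(x, x′) = exp[−i Σ_{x₁∈B(x)} L^{−d} (1/i) log V″(Γ_{x,x₁})] V″(x, x′)  for
⟨x, x′⟩ ∈ Λ′_j, x ∈ Λ′_{j−1}, x′ ∈ Λ′_j, (154) by Eqs. (1.31) in [6]. If we denote by V₁ the configuration on the right-hand sides of (154), then
V₁ = e^{iB} with |B| < 18d²L³Mε₀, (155) for c₁ sufficiently small, and the equalities (154) can be written as Q_j(ηA) = B on Λ′_j, j = 0, 1, …, k,
or simply Q(ηA) = B. (156)»  No derivation of (155) is printed; this file supplies one.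

DICTIONARY (abstract; nothing lattice-specific is re-declared).  `𝔄` = a complete normed ℂ-algebra (the matrix algebra of `G ⊂ U(N)` in the
operator norm); the block `B(x)` = a finite index type `β` with `#β = L^d` (the weights `L^{−d}`); for `x₁ ∈ B(x)` the parallel transport
`V″(Γ_{x,x₁})` = the product of the list `Γ x₁` of bond variables (or their inverses) along the contour, each of norm `≤ 1` (group elements) and
within `9dL²Mε₀ − ε₀` of `1` ((151)), the contour having at most `d·L` bonds (the contours `Γ_{y,x}` of [6] inside one `L`-block); `v = V″(x, x′)`
likewise.  `(1/i) log` = `ilog := (−i)·mlog`; the exponent of (154) = `blockAvg`; `V₁` = `V1`; `B` of (155) = `fieldB := ilog V₁`.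

WHAT THIS FILE PROVES.
* §1 `ilog`, `blockAvg`, `V1`, `fieldB` with unfolding lemmas; `exp_I_smul_ilog` (`e^{i·(1/i)log W} = W` for `|W − 1| < 1`); `norm_ilog_le`
  (`|(1/i)log W| ≤ |W − 1|/(1 − |W − 1|)`); `norm_blockAvg_le` (an `L^{−d}`-weighted sum of `L^d` terms each `≤ α` is `≤ α`).
* §2 **(155) PROVED** (`ineq155`): under (151) for the factors and for `v`, contour lengths `≤ dL`, `d ≥ 1`, `L ≥ 2`, `M ≥ 1`, `ε₀ > 0`, and the
  explicit smallness `9d²L³Mε₀ ≤ 1/16` standing in for «c₁ sufficiently small» (with «9dL²Mε₀ ≦ c₁» it is `c₁ ≤ (16dL)⁻¹`):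
  `‖fieldB‖ < 18d²L³Mε₀`, and `exp_fieldB`: `V₁ = e^{iB}` (`exp (I • fieldB) = V1`).  The chain, with every intermediate constant explicit
  (`norm_transport_sub_one_le`: |V″(Γ) − 1| ≤ dL(9dL²Mε₀ − ε₀) ≤ 1/16; `norm_ilog_transport_le`: |(1/i)log V″(Γ)| ≤ (16/15)dL(9dL²Mε₀ − ε₀);
  `norm_V1_sub_one_le`: |V₁ − 1| ≤ α + α² + (9dL²Mε₀ − ε₀) with α = (16/15)dL(9dL²Mε₀ − ε₀), via |e^{−iX} − 1| ≤ e^{|X|} − 1 ≤ |X| + |X|²;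
  then |B| ≤ |V₁ − 1|/(1 − |V₁ − 1|) ≤ (8/7)|V₁ − 1| < 18d²L³Mε₀).

NOT PROVED HERE, NOT CLAIMED: the identification of `V₁` with the average `Ū₁ʲ` ((154) = (1.31) of [6], row B8.Eq1.31), (156), the geometry
of `ℭ_k`/`Λ′_j` (148); that the printed `c₁` of Theorem 2 [6] can be taken `≤ (16dL)⁻¹` is this file's reading of «for c₁ sufficiently small»
(the series' constants depend on `d`, `L`).  NOT summit progress.
-/

noncomputable section

open Complex NormedSpace

namespace Literature.MathematicalPhysics.QuantumFieldTheory.Balaban1983to89.B11Eq155BlockLog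

open Literature.MathematicalPhysics.QuantumFieldTheory.Balaban1983to89.MatrixLog
open Literature.MathematicalPhysics.QuantumFieldTheory.Balaban1983to89.B11V0Interface (norm_list_prod_sub_one_le_mul)

variable {𝔄 : Type*} [NormedRing 𝔄] [NormedAlgebra ℂ 𝔄]

/-! ## §1  The objects of (154)–(155) -/

section Objects

/-- `(1/i) log W = −i·log W` with the logarithmic series `log = MatrixLog.mlog` ([4] (21)). [cite: Balaban1985Variational, (154) p.302] -/
def ilog (W : 𝔄) : 𝔄 := (-I) • mlog W

/-- Unfolding `ilog`. [cite: Balaban1985Variational, (154) p.302] -/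
theorem ilog_def (W : 𝔄) : ilog W = (-I) • mlog W := rfl

/-- `|(1/i) log W| = |log W|`. [cite: Balaban1985Variational, (154) p.302] -/
theorem norm_ilog (W : 𝔄) : ‖ilog W‖ = ‖mlog W‖ := by
  rw [ilog, norm_smul, norm_neg, Complex.norm_I, one_mul]

/-- `|(1/i) log W| ≤ |W − 1|/(1 − |W − 1|)` for `|W − 1| < 1` (`MatrixLog.norm_mlog_le_div`). [cite: Balaban1985Variational, (155) p.302] -/
theorem norm_ilog_le [CompleteSpace 𝔄] {W : 𝔄} (hW : ‖W - 1‖ < 1) : ‖ilog W‖ ≤ ‖W - 1‖ / (1 - ‖W - 1‖) := by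
  rw [norm_ilog]; exact norm_mlog_le_div hW

/-- `e^{i·(1/i) log W} = W` for `|W − 1| < 1` (`MatrixLog.exp_mlog`). [cite: Balaban1985Variational, (155) p.302] -/
theorem exp_I_smul_ilog [CompleteSpace 𝔄] {W : 𝔄} (hW : ‖W - 1‖ < 1) : exp (I • ilog W) = W := by
  rw [ilog, smul_smul, mul_neg, Complex.I_mul_I, neg_neg, one_smul, exp_mlog hW]

variable {β : Type*} [Fintype β]

/-- **The exponent of (154)**: `X(x) = Σ_{x₁∈B(x)} L^{−d} (1/i) log V″(Γ_{x,x₁})`, the block `B(x)` being the index type `β` (`#β = L^d`) and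
`W x₁ = V″(Γ_{x,x₁})`. [cite: Balaban1985Variational, (154) p.302] -/
def blockAvg (L d : ℕ) (W : β → 𝔄) : 𝔄 := (((L : ℂ) ^ d)⁻¹) • ∑ i, ilog (W i)

/-- **(154)**: `V₁(x, x′) = exp[−i X(x)] V″(x, x′)`. [cite: Balaban1985Variational, (154) p.302] -/
def V1 (L d : ℕ) (W : β → 𝔄) (v : 𝔄) : 𝔄 := exp (-(I • blockAvg L d W)) * v

/-- **(155)**: `B(x, x′) = (1/i) log V₁(x, x′)` («V₁ = e^{iB}»). [cite: Balaban1985Variational, (155) p.302] -/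
def fieldB (L d : ℕ) (W : β → 𝔄) (v : 𝔄) : 𝔄 := ilog (V1 L d W v)

/-- Unfolding `blockAvg`. [cite: Balaban1985Variational, (154) p.302] -/
theorem blockAvg_def (L d : ℕ) (W : β → 𝔄) : blockAvg L d W = (((L : ℂ) ^ d)⁻¹) • ∑ i, ilog (W i) := rfl

/-- Unfolding `V1`. [cite: Balaban1985Variational, (154) p.302] -/
theorem V1_def (L d : ℕ) (W : β → 𝔄) (v : 𝔄) : V1 L d W v = exp (-(I • blockAvg L d W)) * v := rfl

/-- Unfolding `fieldB`. [cite: Balaban1985Variational, (155) p.302] -/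
theorem fieldB_def (L d : ℕ) (W : β → 𝔄) (v : 𝔄) : fieldB L d W v = ilog (V1 L d W v) := rfl

/-- «V₁ = e^{iB}»: `exp (i·B) = V₁` as soon as `|V₁ − 1| < 1`. [cite: Balaban1985Variational, (155) p.302] -/
theorem exp_fieldB_of_lt [CompleteSpace 𝔄] (L d : ℕ) (W : β → 𝔄) (v : 𝔄) (h : ‖V1 L d W v - 1‖ < 1) :
    exp (I • fieldB L d W v) = V1 L d W v :=
  exp_I_smul_ilog h

/-- An `L^{−d}`-weighted sum of `#β = L^d` terms each of norm `≤ α` has norm `≤ α`. [cite: Balaban1985Variational, (154) p.302] -/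
theorem norm_blockAvg_le {L d : ℕ} (hL : 0 < L) (hcard : Fintype.card β = L ^ d) {W : β → 𝔄} {α : ℝ}
    (h : ∀ i, ‖ilog (W i)‖ ≤ α) : ‖blockAvg L d W‖ ≤ α := by
  have hLd : (0 : ℝ) < (L : ℝ) ^ d := by positivity
  have hn : ‖(((L : ℂ) ^ d)⁻¹)‖ = ((L : ℝ) ^ d)⁻¹ := by
    rw [norm_inv, norm_pow, Complex.norm_natCast]
  calc ‖blockAvg L d W‖ ≤ ‖(((L : ℂ) ^ d)⁻¹)‖ * ‖∑ i, ilog (W i)‖ := norm_smul_le _ _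
    _ ≤ ((L : ℝ) ^ d)⁻¹ * ∑ i, ‖ilog (W i)‖ := by rw [hn]; gcongr; exact norm_sum_le _ _
    _ ≤ ((L : ℝ) ^ d)⁻¹ * ∑ _i : β, α := by gcongr with i; exact h i
    _ = α := by
        rw [Finset.sum_const, Finset.card_univ, hcard, nsmul_eq_mul, Nat.cast_pow]
        field_simp

end Objects

/-! ## §2  (155): `|B| < 18d²L³Mε₀` from (151), with an explicit smallness -/

section Ineq155

variable {β : Type*} [Fintype β]

omit [NormedAlgebra ℂ 𝔄] in
/-- The parallel transport along a contour of at most `dL` bonds, each bond variable of norm `≤ 1` and within `9dL²Mε₀ − ε₀` of `1` ((151)),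
is within `dL(9dL²Mε₀ − ε₀)` of `1` (telescoping, `B11V0Interface.norm_list_prod_sub_one_le_mul`). [cite: Balaban1985Variational, (155) p.302] -/
theorem norm_transport_sub_one_le {d L : ℕ} {M ε₀ : ℝ} (hd : 1 ≤ d) (hL : 2 ≤ L) (hM : 1 ≤ M) (hε₀ : 0 < ε₀)
    (Γ : List 𝔄) (h1 : ∀ a ∈ Γ, ‖a‖ ≤ 1) (hδ : ∀ a ∈ Γ, ‖a - 1‖ ≤ 9 * d * L ^ 2 * M * ε₀ - ε₀)
    (hlen : (Γ.length : ℝ) ≤ d * L) :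
    ‖Γ.prod - 1‖ ≤ (d * L : ℝ) * (9 * d * L ^ 2 * M * ε₀ - ε₀) := by
  have hdr : (1 : ℝ) ≤ d := by exact_mod_cast hd
  have hLr : (2 : ℝ) ≤ L := by exact_mod_cast hL
  have hδ0 : 0 ≤ 9 * (d : ℝ) * L ^ 2 * M * ε₀ - ε₀ := by
    have hL2 : (4 : ℝ) ≤ (L : ℝ) ^ 2 := by nlinarith
    have hdl : (4 : ℝ) ≤ d * (L : ℝ) ^ 2 := by nlinarith [mul_nonneg (sub_nonneg.2 hdr) (sub_nonneg.2 hL2)]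
    have hdlm : (4 : ℝ) ≤ d * (L : ℝ) ^ 2 * M := by nlinarith [mul_nonneg (sub_nonneg.2 hdl) (sub_nonneg.2 hM)]
    nlinarith
  exact (norm_list_prod_sub_one_le_mul Γ _ h1 hδ).trans (mul_le_mul_of_nonneg_right hlen hδ0)

/-- The real arithmetic of the chain: with `u = 9dL²Mε₀`, `s = dL ≥ 2`, `su ≤ 1/16`, `0 < ε₀`, `δ′ = u − ε₀`: the quantities
`t ≤ sδ′` (transport deviation), `α = (16/15)sδ′` (bound on the exponent), `b = α + α² + δ′` (bound on |V₁ − 1|) satisfy `b ≤ 1/8` and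
`(8/7)b < 2su = 18d²L³Mε₀`. [cite: Balaban1985Variational, (155) p.302] -/
theorem arith155 {s u ε₀ : ℝ} (hs : 2 ≤ s) (hε₀ : 0 < ε₀) (hu : ε₀ ≤ u) (hsu : s * u ≤ 1 / 16) :
    (16 / 15 * (s * (u - ε₀)) + (16 / 15 * (s * (u - ε₀))) ^ 2 + (u - ε₀) ≤ 1 / 8) ∧
    (8 / 7 * (16 / 15 * (s * (u - ε₀)) + (16 / 15 * (s * (u - ε₀))) ^ 2 + (u - ε₀)) < 2 * s * u) := by
  have hs0 : 0 < s := by linarith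
  have hδ : 0 ≤ u - ε₀ := by linarith
  have hδu : u - ε₀ < u := by linarith
  have hu16 : u ≤ 1 / 32 := by nlinarith
  have ht : s * (u - ε₀) ≤ 1 / 16 := by nlinarith
  have ht0 : 0 ≤ s * (u - ε₀) := mul_nonneg hs0.le hδ
  set t := s * (u - ε₀) with htdef
  have hα : 16 / 15 * t ≤ 1 / 15 := by linarith
  have hα2 : (16 / 15 * t) ^ 2 ≤ (1 / 15) * (16 / 15 * t) := by nlinarith
  constructor
  · nlinarith
  · -- (8/7)(α + α² + δ′) ≤ (8/7)((16/15)α + δ′) ... < 2su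
    have h1 : 16 / 15 * t + (16 / 15 * t) ^ 2 ≤ (16 / 15) * (16 / 15 * t) := by nlinarith
    have h2 : 8 / 7 * ((16 / 15) * (16 / 15 * t) + (u - ε₀)) < 2 * s * u := by
      -- (8/7)(256/225) s δ′ + (8/7) δ′ < (2048/1575) s u + (8/7) u ≤ 2 s u  since s ≥ 2
      have e1 : 8 / 7 * ((16 / 15) * (16 / 15 * t) + (u - ε₀)) ≤ 2048 / 1575 * (s * u) + 8 / 7 * (u - ε₀) := by
        rw [htdef]; nlinarith
      have e2 : 8 / 7 * (u - ε₀) < 8 / 7 * u := by linarith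
      nlinarith
    nlinarith
set_option maxHeartbeats 400000 in
/-- **(155) p. 302 PROVED** — «If we denote by V₁ the configuration on the right-hand sides of (154), then V₁ = e^{iB} with |B| < 18d²L³Mε₀, (155)
for c₁ sufficiently small»: for `V₁ = exp[−iΣ_{x₁∈B(x)}L^{−d}(1/i)log V″(Γ_{x,x₁})]·V″(x,x′)` (`V1`, `#B(x) = L^d`) built from bond variables of
norm `≤ 1` obeying (151) `|V″ − 1| ≤ 9dL²Mε₀ − ε₀`, along contours of at most `dL` bonds, with `d ≥ 1`, `L ≥ 2`, `M ≥ 1`, `ε₀ > 0` and the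
smallness `9d²L³Mε₀ ≤ 1/16` (= «c₁ sufficiently small» made explicit: `c₁ ≤ (16dL)⁻¹` in «9dL²Mε₀ ≦ c₁»), the field `B = (1/i) log V₁`
satisfies `|B| < 18d²L³Mε₀` and `V₁ = e^{iB}`. [cite: Balaban1985Variational, (155) p.302] -/
theorem ineq155 [CompleteSpace 𝔄] {d L : ℕ} {M ε₀ : ℝ} (hd : 1 ≤ d) (hL : 2 ≤ L) (hM : 1 ≤ M) (hε₀ : 0 < ε₀)
    (hsmall : 9 * (d : ℝ) ^ 2 * L ^ 3 * M * ε₀ ≤ 1 / 16) (hcard : Fintype.card β = L ^ d)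
    (Γ : β → List 𝔄) (h1 : ∀ i, ∀ a ∈ Γ i, ‖a‖ ≤ 1) (hδ : ∀ i, ∀ a ∈ Γ i, ‖a - 1‖ ≤ 9 * d * L ^ 2 * M * ε₀ - ε₀)
    (hlen : ∀ i, ((Γ i).length : ℝ) ≤ d * L) {v : 𝔄} (hv1 : ‖v‖ ≤ 1) (hvδ : ‖v - 1‖ ≤ 9 * d * L ^ 2 * M * ε₀ - ε₀) :
    ‖fieldB L d (fun i => (Γ i).prod) v‖ < 18 * (d : ℝ) ^ 2 * L ^ 3 * M * ε₀ ∧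
      exp (I • fieldB L d (fun i => (Γ i).prod) v) = V1 L d (fun i => (Γ i).prod) v := by
  -- the real parameters of the chain
  set s : ℝ := (d : ℝ) * L with hsdef
  set u : ℝ := 9 * (d : ℝ) * L ^ 2 * M * ε₀ with hudef
  have hdr : (1 : ℝ) ≤ d := by exact_mod_cast hd
  have hLr : (2 : ℝ) ≤ L := by exact_mod_cast hL
  have hL0 : 0 < L := by omega
  have hs : 2 ≤ s := by rw [hsdef]; nlinarith
  have hsu : s * u ≤ 1 / 16 := by rw [hsdef, hudef]; nlinarith
  have huε : ε₀ ≤ u := by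
    rw [hudef]
    have hL2 : (4 : ℝ) ≤ (L : ℝ) ^ 2 := by nlinarith
    have hdl : (4 : ℝ) ≤ d * (L : ℝ) ^ 2 := by nlinarith [mul_nonneg (sub_nonneg.2 hdr) (sub_nonneg.2 hL2)]
    have hdlm : (4 : ℝ) ≤ d * (L : ℝ) ^ 2 * M := by nlinarith [mul_nonneg (sub_nonneg.2 hdl) (sub_nonneg.2 hM)]
    nlinarith
  have hδ0 : 0 ≤ u - ε₀ := by linarith
  obtain ⟨hb, hfinal⟩ := arith155 hs hε₀ huε hsu
  have ht16 : s * (u - ε₀) ≤ 1 / 16 := by nlinarith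
  -- transports
  have hW : ∀ i, ‖(Γ i).prod - 1‖ ≤ s * (u - ε₀) := fun i =>
    norm_transport_sub_one_le hd hL hM hε₀ (Γ i) (h1 i) (hδ i) (hlen i)
  -- logarithms of the transports
  have hα : ∀ i, ‖ilog ((Γ i).prod)‖ ≤ 16 / 15 * (s * (u - ε₀)) := by
    intro i
    have hlt : ‖(Γ i).prod - 1‖ < 1 := (hW i).trans_lt (by linarith)
    refine (norm_ilog_le hlt).trans ?_
    rw [div_le_iff₀ (by linarith)]
    nlinarith [hW i, norm_nonneg ((Γ i).prod - 1)]
  -- the exponent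
  have hX : ‖blockAvg L d (fun i => (Γ i).prod)‖ ≤ 16 / 15 * (s * (u - ε₀)) := norm_blockAvg_le hL0 hcard hα
  have hX1 : ‖blockAvg L d (fun i => (Γ i).prod)‖ ≤ 1 := hX.trans (by linarith)
  -- the exponential factor
  set X := blockAvg L d (fun i => (Γ i).prod) with hXdef
  have hE : ‖exp (-(I • X)) - 1‖ ≤ 16 / 15 * (s * (u - ε₀)) + (16 / 15 * (s * (u - ε₀))) ^ 2 := by
    have hn : ‖-(I • X)‖ = ‖X‖ := by rw [norm_neg, norm_smul, Complex.norm_I, one_mul]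
    have e1 : ‖exp (-(I • X)) - 1‖ ≤ Real.exp ‖X‖ - 1 := by
      have := Literature.Analysis.Calculus.norm_exp_sub_one_le (-(I • X)); rwa [hn] at this
    have e2 : Real.exp ‖X‖ - 1 ≤ ‖X‖ + ‖X‖ ^ 2 := by
      have habs : |‖X‖| ≤ 1 := by rw [abs_of_nonneg (norm_nonneg _)]; exact hX1
      have := Real.abs_exp_sub_one_sub_id_le habs
      have := (abs_le.mp this).2
      linarith
    have e3 : ‖X‖ + ‖X‖ ^ 2 ≤ 16 / 15 * (s * (u - ε₀)) + (16 / 15 * (s * (u - ε₀))) ^ 2 := by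
      nlinarith [hX, norm_nonneg X]
    linarith
  -- V₁ − 1 = (E − 1)v + (v − 1)
  have hV : ‖V1 L d (fun i => (Γ i).prod) v - 1‖
      ≤ 16 / 15 * (s * (u - ε₀)) + (16 / 15 * (s * (u - ε₀))) ^ 2 + (u - ε₀) := by
    have e : V1 L d (fun i => (Γ i).prod) v - 1 = (exp (-(I • X)) - 1) * v + (v - 1) := by
      rw [V1_def, ← hXdef]; noncomm_ring
    rw [e]
    calc ‖(exp (-(I • X)) - 1) * v + (v - 1)‖ ≤ ‖exp (-(I • X)) - 1‖ * ‖v‖ + ‖v - 1‖ :=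
          norm_add_le_of_le (norm_mul_le _ _) le_rfl
      _ ≤ (16 / 15 * (s * (u - ε₀)) + (16 / 15 * (s * (u - ε₀))) ^ 2) * 1 + (u - ε₀) := by
          gcongr
      _ = 16 / 15 * (s * (u - ε₀)) + (16 / 15 * (s * (u - ε₀))) ^ 2 + (u - ε₀) := by ring
  have hVlt : ‖V1 L d (fun i => (Γ i).prod) v - 1‖ < 1 := hV.trans_lt (hb.trans_lt (by norm_num))
  refine ⟨?_, exp_fieldB_of_lt L d _ v hVlt⟩
  -- B = (1/i) log V₁
  have hB : ‖fieldB L d (fun i => (Γ i).prod) v‖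
      ≤ 8 / 7 * (16 / 15 * (s * (u - ε₀)) + (16 / 15 * (s * (u - ε₀))) ^ 2 + (u - ε₀)) := by
    rw [fieldB_def]
    refine (norm_ilog_le hVlt).trans ?_
    rw [div_le_iff₀ (by linarith)]
    nlinarith [hV, hb, norm_nonneg (V1 L d (fun i => (Γ i).prod) v - 1)]
  have h18 : 2 * s * u = 18 * (d : ℝ) ^ 2 * L ^ 3 * M * ε₀ := by rw [hsdef, hudef]; ring
  linarith

end Ineq155

end Literature.MathematicalPhysics.QuantumFieldTheory.Balaban1983to89.B11Eq155BlockLog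

end
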